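import Literature.NumberTheory.LFunctions.Zhang2022.KnifeEdgeLenZDegreePsi
import Literature.NumberTheory.LFunctions.Zhang2022.KnifeEdgeRoughOverhang

/-!
# Zhang (2022), rung F-S3 (Landau–Siegel programme, §D edge len = E*-len⁺): card `z-degree-toeplitz-band` — the
# BARRIER BRANCH of K2 as a typed target, «graded B-AH⁺: the Z-graded main-term matrices are positive semidefinite on
# every in-class design» (`GradedPSD`, OPEN), the DICHOTOMY `GradedCloses ↔ ¬ GradedPSD` (PROVED), and UNIQUENESS of
# the slots' named functionals (PROVED)

Y. Zhang, *Discrete mean estimates and the Landau–Siegel zero*, arXiv:2211.02515v1 [Zhang2022LandauSiegel] —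
an unrefereed manuscript under adjudication. **WHAT THIS IS NOT: not a claim about Theorems 1–2 of
arXiv:2211.02515, about Landau–Siegel zeros, or about Parity. The programme SEARCHES and TYPES; no claim about
Landau–Siegel zeros, Theorems 1–2 of arXiv:2211.02515 or a repaired Margin232 until a kernel theorem says so.
`GradedPSD X₁ Y₁ X₂` is a bare `Prop` (the barrier-branch statement, asserted by no one); every `theorem` is finite
linear algebra about `gradedMainMatrix` / `gradedQuadForm` / `GradedCloses` of `KnifeEdgeLenZDegree`.**

CONTEXT (cell landau-siegel §D, BIRTH (4); director-frontier 2026-08-27T01:42:55Z «K2 = M–L with the LIKELY PRODUCT the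
barrier branch (a graded B-AH⁺ theorem)»; critic ls-knife-crit-1 g2 s3 / 01:37:27Z (4) «K2's expected product is the barrier
branch: the Z-graded main-term Toeplitz matrices are PSD at main order on (A)-data, K3-type theorem»; card v3 K2 text). The
card's K2 is a DICHOTOMY between the closing alternative `GradedCloses X₁ Y₁ X₂` (some in-class design has negative main
quadratic form ⇒ Theorem 1 by `theorem1_of_gradedClosesPsi_allC`) and its barrier branch. This file NAMES the barrier branch
as a typed target and proves that the two horns are exactly complementary:
* `GradedPSD X₁ Y₁ X₂` — for every in-class triple `(f, g₁, g₂)` the `3×3` main-term matrix is positive semidefinite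
  (graded B-AH⁺ at main order; the same statement serves the `Z(·,χψ)`- and `Z(·,ψ)`-graded lines, which share
  `gradedMainMatrix`);
* `gradedQuadForm_nonneg_of_posSemidef` — a PSD main matrix has non-negative quadratic form on every amplitude vector;
* **`not_gradedCloses_iff_gradedPSD`**, `gradedCloses_iff_not_gradedPSD`, `gradedCloses_or_gradedPSD` — the dichotomy
  (exactly one horn holds, classically);
* Part 2 (C0 pin P-X, option β — what the slots PIN): `asympConst_unique` (an (A)-conditional `𝔞𝔓`-asymptotic
  determines its constant unless (A) fails for all large `D`), `crossTablePsi_unique`, `dualCrossTablePsi_unique`,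
  `crossTable_unique`, `gramEntryAsymp_unique` (the other horn gives the goal outright: tree
  `KnifeEdgeEll.Vernier.theorem1_of_notAEventually`) — so a packaged crux `∃ X₁ Y₁ X₂, slots ∧ GradedCloses X₁ Y₁ X₂` is not the vacuous own-`∃` of desk ZD2;
* Part 3 (desk ZD1, landed at the C0's request 02:00:52Z): `not_gradedCloses_allDark : ¬ GradedCloses 0 0 0`, `gradedPSD_allDark`;
* `schurBound_of_gradedPSD_dark` — at `X₂ = 0` the barrier branch entails the tridiagonal Schur bound
  `|X₁(f,g₁)|²/𝔅(f) + |Y₁(g₁,g₂)|²/𝔅(g₂) ≤ 𝔅(g₁)` on every in-class triple with `𝔅(f), 𝔅(g₂) > 0` (contrapositive of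
  `gradedCloses_dark_of_schur`), and `Y₁ = 0` against every kernel pair (contrapositive of `gradedCloses_dark_of_kernelPair`).

Typer: ls-knife-typer-1 (cell landau-siegel §D).

## References
* Y. Zhang, arXiv:2211.02515v1 (2022), §2 (2.16)–(2.17), §7 Prop 7.1 (7.2). [cite: Zhang2022LandauSiegel, §2 (2.16), §7 Prop 7.1]
-/

noncomputable section

open Complex Real ComplexConjugate Matrix
open scoped ComplexOrder

namespace Literature.NumberTheory.LFunctions.Zhang2022.KnifeEdge

open Repair Skeleton

section Barrier

variable {X₁ Y₁ X₂ : PairFunctional}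

/-- **GRADED B-AH⁺ — the barrier branch of K2 as a typed target (OPEN — asserted by no one):** for every in-class
triple of profiles the ⟨A⟩-main-term matrix of the graded design is positive semidefinite («the Z-graded main-term
Toeplitz matrices are PSD at main order on (A)-data»). The expected product of the line per the director/critic; its
negation is exactly the closing alternative (`gradedCloses_iff_not_gradedPSD`). [cite: Zhang2022LandauSiegel, §2 (2.16), §7 Prop 7.1 (7.2)] -/
def GradedPSD (X₁ Y₁ X₂ : PairFunctional) : Prop :=
  ∀ (f f' g₁ g₁' g₂ g₂' : ℝ → ℂ), InClassPiece f f' → InClassPiece g₁ g₁' → InClassPiece g₂ g₂' →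
    (gradedMainMatrix X₁ Y₁ X₂ f f' g₁ g₁' g₂ g₂').PosSemidef

/-- the Gram form of the amplitudes `s` is the matrix quadratic form at `x = star s` (pure algebra). [folklore] -/
private theorem quadForm_eq_star (M : Matrix (Fin 3) (Fin 3) ℂ) (s : Fin 3 → ℂ) :
    (∑ a, ∑ b, s a * conj (s b) * M a b) = star (star s) ⬝ᵥ (M *ᵥ (star s)) := by
  simp only [dotProduct, Matrix.mulVec, Pi.star_apply, Complex.star_def, Complex.conj_conj, Finset.mul_sum]
  refine Finset.sum_congr rfl fun a _ => Finset.sum_congr rfl fun b _ => ?_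
  ring

/-- **A PSD main-term matrix has non-negative quadratic form on every amplitude vector.** [cite: Zhang2022LandauSiegel, §2 (2.16)] -/
theorem gradedQuadForm_nonneg_of_posSemidef {M : Matrix (Fin 3) (Fin 3) ℂ} (hM : M.PosSemidef) (s : Fin 3 → ℂ) :
    0 ≤ gradedQuadForm M s := by
  unfold gradedQuadForm
  rw [quadForm_eq_star]
  exact (Complex.le_def.mp (hM.dotProduct_mulVec_nonneg (star s))).1

/-- **The barrier branch excludes closing:** `GradedPSD ⇒ ¬ GradedCloses`. [cite: Zhang2022LandauSiegel, §2 (2.16)] -/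
theorem not_gradedCloses_of_gradedPSD (h : GradedPSD X₁ Y₁ X₂) : ¬ GradedCloses X₁ Y₁ X₂ := by
  rintro ⟨f, f', g₁, g₁', g₂, g₂', s, hf, hg₁, hg₂, hneg⟩
  exact absurd hneg (not_lt.mpr (gradedQuadForm_nonneg_of_posSemidef (h f f' g₁ g₁' g₂ g₂' hf hg₁ hg₂) s))

/-- **No closing ⇒ the barrier branch** (contrapositive of `gradedCloses_of_not_posSemidef`). [cite: Zhang2022LandauSiegel, §2 (2.16)] -/
theorem gradedPSD_of_not_gradedCloses (h : ¬ GradedCloses X₁ Y₁ X₂) : GradedPSD X₁ Y₁ X₂ := by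
  intro f f' g₁ g₁' g₂ g₂' hf hg₁ hg₂
  by_contra hpsd
  exact h (gradedCloses_of_not_posSemidef hf hg₁ hg₂ hpsd)

/-- **THE K2 DICHOTOMY (proved): `¬ GradedCloses ↔ GradedPSD`** — the two horns of the card's K2 are exactly
complementary; the line's product is EITHER an E*-len⁺ inhabitant (Theorem 1 via `theorem1_of_gradedClosesPsi_allC`) OR the
barrier theorem graded B-AH⁺. [cite: Zhang2022LandauSiegel, §2 (2.16), §7 Prop 7.1 (7.2)] -/
theorem not_gradedCloses_iff_gradedPSD : ¬ GradedCloses X₁ Y₁ X₂ ↔ GradedPSD X₁ Y₁ X₂ :=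
  ⟨gradedPSD_of_not_gradedCloses, not_gradedCloses_of_gradedPSD⟩

/-- … equivalently `GradedCloses ↔ ¬ GradedPSD`. [cite: Zhang2022LandauSiegel, §2 (2.16)] -/
theorem gradedCloses_iff_not_gradedPSD : GradedCloses X₁ Y₁ X₂ ↔ ¬ GradedPSD X₁ Y₁ X₂ := by
  rw [← not_gradedCloses_iff_gradedPSD, not_not]

/-- … and one horn always holds. [cite: Zhang2022LandauSiegel, §2 (2.16)] -/
theorem gradedCloses_or_gradedPSD : GradedCloses X₁ Y₁ X₂ ∨ GradedPSD X₁ Y₁ X₂ := by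
  rw [← not_gradedCloses_iff_gradedPSD]
  exact em _

/-- **At `X₂ = 0` the barrier branch is the tridiagonal SCHUR BOUND** on every in-class triple with `𝔅(f), 𝔅(g₂) > 0`:
`|X₁(f,g₁)|²/𝔅(f) + |Y₁(g₁,g₂)|²/𝔅(g₂) ≤ 𝔅(g₁)` (contrapositive of `gradedCloses_dark_of_schur`) — what a graded B-AH⁺
theorem must establish for the degree-1 tables when `τ₂` is dark. [cite: Zhang2022LandauSiegel, §2 (2.16), §7 Prop 7.1 (7.2)] -/
theorem schurBound_of_gradedPSD_dark (h : GradedPSD X₁ Y₁ 0) {f f' g₁ g₁' g₂ g₂' : ℝ → ℂ} (hf : InClassPiece f f')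
    (hg₁ : InClassPiece g₁ g₁') (hg₂ : InClassPiece g₂ g₂') (hB0 : 0 < mainTermForm f f')
    (hB2 : 0 < mainTermForm g₂ g₂') :
    ‖X₁ f f' g₁ g₁'‖ ^ 2 / mainTermForm f f' + ‖Y₁ g₁ g₁' g₂ g₂'‖ ^ 2 / mainTermForm g₂ g₂' ≤ mainTermForm g₁ g₁' := by
  by_contra hlt
  exact not_gradedCloses_of_gradedPSD h (gradedCloses_dark_of_schur hf hg₁ hg₂ hB0 hB2 (not_le.mp hlt))

/-- **At `X₂ = 0` the barrier branch forces the dual table to VANISH against every kernel pair:** `GradedPSD X₁ Y₁ 0`,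
`𝔅(f)𝔅(g₁) = |X₁(f,g₁)|²`, `𝔅(f) ≠ 0` ⇒ `Y₁(g₁,g₂) = 0` for every in-class `g₂` (contrapositive of
`gradedCloses_dark_of_kernelPair`; the AFE/moment-sequence model's prediction, critic 01:22:21Z (4)). [cite: Zhang2022LandauSiegel, §2 (2.16), (2.32)] -/
theorem dualTable_eq_zero_of_gradedPSD_dark (h : GradedPSD X₁ Y₁ 0) {f f' g₁ g₁' g₂ g₂' : ℝ → ℂ}
    (hf : InClassPiece f f') (hg₁ : InClassPiece g₁ g₁') (hg₂ : InClassPiece g₂ g₂')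
    (hker : (mainTermForm f f' : ℂ) * (mainTermForm g₁ g₁' : ℂ) = conj (X₁ f f' g₁ g₁') * X₁ f f' g₁ g₁')
    (hB0 : mainTermForm f f' ≠ 0) : Y₁ g₁ g₁' g₂ g₂' = 0 := by
  by_contra hY
  exact not_gradedCloses_of_gradedPSD h (gradedCloses_dark_of_kernelPair hf hg₁ hg₂ hker hB0 hY)

end Barrier

/-! ### Part 2 — what the slots PIN: uniqueness of the named constants unless (A) fails eventually (C0 pin P-X, option β) -/

section Unique

/-- **An (A)-conditional `𝔞𝔓`-asymptotic pins its constant (proved):** if a `D`-indexed quantity `T(D,χ)` is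
`m·𝔞𝔓 + o(𝔞𝔓)` AND `m′·𝔞𝔓 + o(𝔞𝔓)` under (A) eventually, then `m = m′` — unless (A) fails for every real primitive
character to every large modulus (in which case every such slot is vacuous and `Theorem1` holds outright,
`Skeleton.theorem1_of_eventually_not_assumptionA`). Uses `𝔞 ≥ a₀ > 0` under (A) (`frakALowerBound_holds`) and `𝔓 > 0`.
So a packaged crux `∃ X, slot(X) ∧ closing(X)` is NOT the vacuous own-∃ of desk ZD2: the slot determines `X` on its
arguments. [cite: Zhang2022LandauSiegel, §2 p. 4, (2.9), (2.31)] -/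
theorem asympConst_unique {T : (D : ℕ) → [NeZero D] → DirichletCharacter ℂ D → ℂ} {m m' : ℂ}
    (h : ∀ ε : ℝ, 0 < ε → ForAllLarge fun D _ χ => AssumptionA D χ →
      ‖T D χ - m * frakA χ * frakP D‖ ≤ ε * frakA χ * frakP D)
    (h' : ∀ ε : ℝ, 0 < ε → ForAllLarge fun D _ χ => AssumptionA D χ →
      ‖T D χ - m' * frakA χ * frakP D‖ ≤ ε * frakA χ * frakP D)
    (hA : ¬ ForAllLarge fun D _ χ => ¬ AssumptionA D χ) : m = m' := by
  by_contra hne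
  have hδ : 0 < ‖m - m'‖ := norm_pos_iff.mpr (sub_ne_zero.mpr hne)
  set ε : ℝ := ‖m - m'‖ / 3 with hε_def
  have hε : 0 < ε := by positivity
  obtain ⟨a₀, ha₀, hAlb⟩ := frakALowerBound_holds
  obtain ⟨D₃, h₃⟩ := frakP_eventually_pos
  obtain ⟨D₁, h₁⟩ := ((h ε hε).and (h' ε hε)).and hAlb
  apply hA
  refine ⟨max D₁ D₃, fun D _ χ hD hq hp hAss => ?_⟩
  obtain ⟨⟨e1, e2⟩, ea⟩ := h₁ D χ (le_trans (le_max_left _ _) hD) hq hp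
  have hA0 : 0 < frakA χ := lt_of_lt_of_le ha₀ (ea hAss)
  have hP0 : 0 < frakP D := h₃ D (le_trans (le_max_right _ _) hD)
  have hX : 0 < frakA χ * frakP D := mul_pos hA0 hP0
  have hdiff : ‖(m - m') * ((frakA χ * frakP D : ℝ) : ℂ)‖ ≤ 2 * ε * (frakA χ * frakP D) := by
    have := norm_sub_le (T D χ - m' * frakA χ * frakP D) (T D χ - m * frakA χ * frakP D)
    have hrw : T D χ - m' * frakA χ * frakP D - (T D χ - m * frakA χ * frakP D) =
        (m - m') * ((frakA χ * frakP D : ℝ) : ℂ) := by push_cast; ring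
    rw [hrw] at this
    have e1' := e1 hAss
    have e2' := e2 hAss
    nlinarith [this, e1', e2']
  rw [norm_mul, Complex.norm_real, Real.norm_of_nonneg hX.le] at hdiff
  have : ‖m - m'‖ ≤ 2 * ε := le_of_mul_le_mul_right (by nlinarith [hdiff]) hX
  rw [hε_def] at this
  linarith

variable {c' : ℝ} {X X' : PairFunctional}

/-- **`CrossTablePsi` pins its functional** on in-class pieces (unless (A) fails eventually). [cite: Zhang2022LandauSiegel, §8 (8.5)] -/
theorem crossTablePsi_unique {d : ℕ} (h : CrossTablePsi c' d X) (h' : CrossTablePsi c' d X')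
    (hA : ¬ ForAllLarge fun D _ χ => ¬ AssumptionA D χ) {f f' g g' : ℝ → ℂ} (hf : InClassPiece f f')
    (hg : InClassPiece g g') : X f f' g g' = X' f f' g g' :=
  asympConst_unique (T := fun D _ χ => zDegMeanPsi c' χ d
      (fun x t => conj (profPoly χ x g (⌊bigP D⌋₊ + 1) t)) (fun x t => profPoly χ x f (⌊bigP D⌋₊ + 1) t))
    (fun ε hε => h f f' g g' hf hg ε hε) (fun ε hε => h' f f' g g' hf hg ε hε) hA

/-- **`DualCrossTablePsi` pins its functional** on in-class pieces (unless (A) fails eventually). [cite: Zhang2022LandauSiegel, §8 (8.5)] -/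
theorem dualCrossTablePsi_unique {d : ℕ} (h : DualCrossTablePsi c' d X) (h' : DualCrossTablePsi c' d X')
    (hA : ¬ ForAllLarge fun D _ χ => ¬ AssumptionA D χ) {g₁ g₁' g₂ g₂' : ℝ → ℂ} (hg₁ : InClassPiece g₁ g₁')
    (hg₂ : InClassPiece g₂ g₂') : X g₁ g₁' g₂ g₂' = X' g₁ g₁' g₂ g₂' :=
  asympConst_unique (T := fun D _ χ => zDegMeanPsi c' χ d
      (fun x t => conj (profPoly χ x g₂ (⌊bigP D⌋₊ + 1) t)) (fun x t => conj (profPoly χ x g₁ (⌊bigP D⌋₊ + 1) t)))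
    (fun ε hε => h g₁ g₁' g₂ g₂' hg₁ hg₂ ε hε) (fun ε hε => h' g₁ g₁' g₂ g₂' hg₁ hg₂ ε hε) hA

/-- **`CrossTable` (unit `Z(·,χψ)`) pins its functional** likewise. [cite: Zhang2022LandauSiegel, §8 (8.5)] -/
theorem crossTable_unique {d : ℕ} (h : CrossTable c' d X) (h' : CrossTable c' d X')
    (hA : ¬ ForAllLarge fun D _ χ => ¬ AssumptionA D χ) {f f' g g' : ℝ → ℂ} (hf : InClassPiece f f')
    (hg : InClassPiece g g') : X f f' g g' = X' f f' g g' :=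
  asympConst_unique (T := fun D _ χ => zDegMean c' χ d
      (fun x t => conj (profPoly χ x g (⌊bigP D⌋₊ + 1) t)) (fun x t => profPoly χ x f (⌊bigP D⌋₊ + 1) t))
    (fun ε hε => h f f' g g' hf hg ε hε) (fun ε hε => h' f f' g g' hf hg ε hε) hA

/-- **A Gram-entry slot pins its constant** (generic). [cite: Zhang2022LandauSiegel, §2 (2.16)–(2.17)] -/
theorem gramEntryAsymp_unique {U V : DTable} {m m' : ℂ} (h : GramEntryAsymp c' U V m) (h' : GramEntryAsymp c' U V m')
    (hA : ¬ ForAllLarge fun D _ χ => ¬ AssumptionA D χ) : m = m' :=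
  asympConst_unique (T := fun D _ χ => discPolar c' χ (U D χ) (V D χ)) h h' hA

-- The (A)-fails-eventually horn gives Theorem 1 outright: tree `KnifeEdgeEll.Vernier.theorem1_of_notAEventually`
-- (KnifeEdgeEllVernierVacuity.lean) — so «slots vacuous» is never a loss.

end Unique

/-! ### Part 3 — sanity of record (tribunal desk ZD1): with ALL tables dark nothing closes -/

section AllDark

/-- **All tables dark ⇒ no design closes** (`¬ GradedCloses 0 0 0`; the tribunal desk's ZD1, frontier-trib-ls-1 g5 probe
ZDegreeJunk.lean 0fda36fc1752bacd, 2026-08-27T01:22:36Z): with `X₁ = Y₁ = X₂ = 0` the main matrix is the diagonal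
`(𝔅(f), 𝔅(g₁), 𝔅(g₂))`, PSD by Zhang's `𝔅 ≥ 0` on kinked in-class profiles (`mainTermForm_nonneg_of_isH1`). The closing
alternative therefore has content only through the NAMED degree-1/degree-2 tables. [cite: Zhang2022LandauSiegel, §2 (2.16), §7 Prop 7.1] -/
theorem not_gradedCloses_allDark : ¬ GradedCloses 0 0 0 := by
  rintro ⟨f, f', g₁, g₁', g₂, g₂', s, hf, hg₁, hg₂, hneg⟩
  rw [gradedQuadForm_dark] at hneg
  simp only [Pi.zero_apply, mul_zero, map_zero, Complex.zero_re, add_zero] at hneg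
  have h0 := mainTermForm_nonneg_of_isH1 hf.kinked.isH1
  have h1 := mainTermForm_nonneg_of_isH1 hg₁.kinked.isH1
  have h2 := mainTermForm_nonneg_of_isH1 hg₂.kinked.isH1
  nlinarith [mul_nonneg h0 (sq_nonneg ‖s 0‖), mul_nonneg h1 (sq_nonneg ‖s 1‖), mul_nonneg h2 (sq_nonneg ‖s 2‖)]

/-- … equivalently the all-dark main matrices are PSD on every in-class triple (`GradedPSD 0 0 0`). [cite: Zhang2022LandauSiegel, §2 (2.16)] -/
theorem gradedPSD_allDark : GradedPSD 0 0 0 := gradedPSD_of_not_gradedCloses not_gradedCloses_allDark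

end AllDark

/-! ### Part 4 — the dichotomy of record for the birth packet's BC5/T1 line (proved): (A) fails eventually and
Theorem 1 holds outright, OR every ψ-graded slot pins its functional on in-class pieces -/

section Dichotomy

/-- **Theorem 1 outright, or the slots pin the functionals (proved):** either (A) fails for every real primitive
character to every large modulus — then `Skeleton.Theorem1` holds (`Skeleton.theorem1_of_eventually_not_assumptionA`,
the manuscript's p. 6 bookkeeping) and every (A)-guarded slot is vacuous (`KnifeEdgeLenZDegreePack` Part 3,
`gradedClosesPsi_of_notAEventually`) — or (A) holds infinitely often, and then any two pair functionals filling the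
same cross-table slot `CrossTablePsi c′ d ·` agree on in-class pieces (`crossTablePsi_unique`), likewise for the dual
slot. So the packaged crux `GradedClosesPsi c′ = ∃ X₁ Y₁ X₂, slots ∧ GradedCloses X₁ Y₁ X₂` is never the vacuous
own-`∃` where it matters. [cite: Zhang2022LandauSiegel, §2 p. 4, p. 6, §8 (8.5)] -/
theorem theorem1_or_slots_pin (c' : ℝ) :
    Theorem1 ∨
      ((∀ (d : ℕ) (X X' : PairFunctional), CrossTablePsi c' d X → CrossTablePsi c' d X' →
          ∀ (f f' g g' : ℝ → ℂ), InClassPiece f f' → InClassPiece g g' → X f f' g g' = X' f f' g g') ∧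
        ∀ (d : ℕ) (Y Y' : PairFunctional), DualCrossTablePsi c' d Y → DualCrossTablePsi c' d Y' →
          ∀ (g₁ g₁' g₂ g₂' : ℝ → ℂ), InClassPiece g₁ g₁' → InClassPiece g₂ g₂' →
            Y g₁ g₁' g₂ g₂' = Y' g₁ g₁' g₂ g₂') := by
  by_cases hA : ForAllLarge fun D _ χ => ¬ AssumptionA D χ
  · exact Or.inl (Skeleton.theorem1_of_eventually_not_assumptionA hA)
  · exact Or.inr ⟨fun d X X' h h' f f' g g' hf hg => crossTablePsi_unique h h' hA hf hg,
      fun d Y Y' h h' g₁ g₁' g₂ g₂' hg₁ hg₂ => dualCrossTablePsi_unique h h' hA hg₁ hg₂⟩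

/-- **The packaged functionals are pinned unless Theorem 1 already holds (proved):** two witnesses
`(X₁, Y₁, X₂)`, `(X₁′, Y₁′, X₂′)` of the slot part of `GradedClosesPsi c′` agree on all in-class arguments, or
`Theorem1`. [cite: Zhang2022LandauSiegel, §2 p. 6, §8 (8.5)] -/
theorem theorem1_or_witnesses_agree (c' : ℝ) {X₁ Y₁ X₂ X₁' Y₁' X₂' : PairFunctional}
    (h1 : CrossTablePsi c' 1 X₁) (h21 : DualCrossTablePsi c' 1 Y₁) (h2 : TauTwoTablePsi c' X₂)
    (h1' : CrossTablePsi c' 1 X₁') (h21' : DualCrossTablePsi c' 1 Y₁') (h2' : TauTwoTablePsi c' X₂') :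
    Theorem1 ∨
      ∀ (f f' g₁ g₁' g₂ g₂' : ℝ → ℂ), InClassPiece f f' → InClassPiece g₁ g₁' → InClassPiece g₂ g₂' →
        X₁ f f' g₁ g₁' = X₁' f f' g₁ g₁' ∧ Y₁ g₁ g₁' g₂ g₂' = Y₁' g₁ g₁' g₂ g₂' ∧ X₂ f f' g₂ g₂' = X₂' f f' g₂ g₂' := by
  rcases theorem1_or_slots_pin c' with hT | ⟨hX, hY⟩
  · exact Or.inl hT
  · exact Or.inr fun f f' g₁ g₁' g₂ g₂' hf hg₁ hg₂ =>
      ⟨hX 1 X₁ X₁' h1 h1' f f' g₁ g₁' hf hg₁, hY 1 Y₁ Y₁' h21 h21' g₁ g₁' g₂ g₂' hg₁ hg₂,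
        hX 2 X₂ X₂' h2 h2' f f' g₂ g₂' hf hg₂⟩

end Dichotomy

/-! ### Part 5 — on the (A)-infinitely-often horn the slot-pinned matrix IS PSD (the glue read contrapositively;
the critic's P-formula (ii), 2026-08-27T02:44:00Z / 02:52:02Z): so `GradedPSD` of the TRUE functionals is not a separate
barrier theorem to be proved from the slots — it is automatic there — and the deciding content is formula-level -/

section HornPSD

variable {c' : ℝ} {X₁ Y₁ X₂ : PairFunctional}

/-- **Slots ∧ (A) infinitely often ⇒ `GradedPSD` (proved):** given the in-class means, Prop. 2.2 (i) and Lemma 2.3 at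
`c′`, functionals filling the three ψ-graded slots have PSD main matrices on every in-class triple UNLESS (A) fails
eventually — because a non-PSD triple would close (`gradedCloses_of_not_posSemidef`) and the Gram endgame
(`eventually_not_assumptionA_of_gramSlots` on `gramEntryAsymp_psi`) would then refute (A) eventually. This is the glue read
contrapositively, not new content: «barrier-by-Gram» for the slot-pinned functionals is automatic on this horn.
[cite: Zhang2022LandauSiegel, §2 p. 6, (2.16), §7 Prop 7.1] -/
theorem gradedPSD_of_slots_of_notA_io (h0 : InClassMean c') (h22 : Prop22i) (h23 : Lemma23 c')
    (h1 : CrossTablePsi c' 1 X₁) (h21 : DualCrossTablePsi c' 1 Y₁) (h2 : TauTwoTablePsi c' X₂)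
    (hA : ¬ ForAllLarge fun D _ χ => ¬ AssumptionA D χ) : GradedPSD X₁ Y₁ X₂ := by
  refine gradedPSD_of_not_gradedCloses fun hC => hA ?_
  obtain ⟨f, f', g₁, g₁', g₂, g₂', s, hf, hg₁, hg₂, hneg⟩ := hC
  exact eventually_not_assumptionA_of_gramSlots (gramEntryAsymp_psi h0 h1 h21 h2 h22 hf hg₁ hg₂) hneg h22 h23

/-- **The trichotomy collapses to a dichotomy for slot-satisfying functionals (proved):** given the side conditions,
EITHER (A) fails eventually (and `Theorem1` holds, `Skeleton.theorem1_of_eventually_not_assumptionA`) OR the main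
matrices of `X₁, Y₁, X₂` are PSD on every in-class triple; `GradedCloses X₁ Y₁ X₂` is the first horn's certificate.
[cite: Zhang2022LandauSiegel, §2 p. 6, (2.16)] -/
theorem notAEventually_or_gradedPSD_of_slots (h0 : InClassMean c') (h22 : Prop22i) (h23 : Lemma23 c')
    (h1 : CrossTablePsi c' 1 X₁) (h21 : DualCrossTablePsi c' 1 Y₁) (h2 : TauTwoTablePsi c' X₂) :
    (ForAllLarge fun D _ χ => ¬ AssumptionA D χ) ∨ GradedPSD X₁ Y₁ X₂ := by
  by_cases hA : ForAllLarge fun D _ χ => ¬ AssumptionA D χ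
  · exact Or.inl hA
  · exact Or.inr (gradedPSD_of_slots_of_notA_io h0 h22 h23 h1 h21 h2 hA)

end HornPSD

/-! ### Part 6 — the α1 JUNK GUARD (C0, critic ls-knife-crit-1 g2 2026-08-27T03:00:20Z, kernel demo `ZDegJunk.lean`
ab2bbe0aebcfeb52 re-typed here): a table that does not vanish on the ZERO profile closes `GradedCloses` trivially
(`inClassPiece_zero` puts the zero profile in class), so the closed-form tables of item α1 must be genuine sesquilinear
functionals of the profiles — at least `VanishesOnZero` on every leg — or α3 is true by junk and its barrier twin false by junk -/

section JunkGuard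

/-- `𝔅(0) = 0`: the main-term form of the zero profile vanishes. [cite: Zhang2022LandauSiegel, §7 Prop 7.1 (7.2)] -/
theorem mainTermForm_zero_profile : mainTermForm (fun _ => (0:ℂ)) (fun _ => (0:ℂ)) = 0 := by
  simp [mainTermForm_eq]

/-- **JUNK (proved): the constant cross table `1` closes** — `GradedCloses (fun _ _ _ _ => 1) 0 0` via the zero profile on
leg 0 (`inClassPiece_zero`), `g⋆` on legs 1, 2 and amplitudes `(−𝔅(g⋆)−1, 1, 0)`: form `= −𝔅(g⋆) − 2 < 0`. A constant
table is not sesquilinear; this is why α1's tables must vanish on the zero profile. [cite: Zhang2022LandauSiegel, §2 (2.16), §7 Prop 7.1] -/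
theorem gradedCloses_of_junk_table : GradedCloses (fun _ _ _ _ => (1:ℂ)) 0 0 := by
  refine ⟨fun _ => 0, fun _ => 0, gStar, gStar', gStar, gStar',
    ![-((mainTermForm gStar gStar' : ℂ) + 1), 1, 0], inClassPiece_zero, inClassPiece_gStar, inClassPiece_gStar, ?_⟩
  simp [gradedQuadForm, gradedMainMatrix, Fin.sum_univ_three, mainTermForm_zero_profile, Complex.conj_ofReal]
  have hB : 0 ≤ mainTermForm gStar gStar' := mainTermForm_nonneg_of_isH1 inClassPiece_gStar.kinked.isH1
  nlinarith

/-- … so the barrier twin of the junk table is FALSE by junk, not by arithmetic. [cite: Zhang2022LandauSiegel, §2 (2.16)] -/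
theorem not_gradedPSD_of_junk_table : ¬ GradedPSD (fun _ _ _ _ => (1:ℂ)) 0 0 :=
  fun h => not_gradedCloses_of_gradedPSD h gradedCloses_of_junk_table

/-- **The minimal junk guard for a pair functional (shape):** it vanishes whenever either leg is the ZERO profile
(`(0, 0)` as (profile, derivative)). Genuine sesquilinear integral functionals of the profiles satisfy it; the critic's
α1 item text asks the closed-form tables `X₁^ψ, Y₁^ψ, X₂^ψ` to be such. [cite: Zhang2022LandauSiegel, §7 Prop 7.1 (7.2)] -/
def VanishesOnZero (X : PairFunctional) : Prop :=
  (∀ g g' : ℝ → ℂ, X (fun _ => 0) (fun _ => 0) g g' = 0) ∧ ∀ f f' : ℝ → ℂ, X f f' (fun _ => 0) (fun _ => 0) = 0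

/-- The zero table passes the guard (all-dark tables are not junk — and do not close, `not_gradedCloses_allDark`).
[cite: Zhang2022LandauSiegel, §2 (2.16)] -/
theorem vanishesOnZero_zero : VanishesOnZero 0 := ⟨fun _ _ => rfl, fun _ _ => rfl⟩

/-- The junk table fails the guard. [cite: Zhang2022LandauSiegel, §2 (2.16)] -/
theorem not_vanishesOnZero_junk_table : ¬ VanishesOnZero (fun _ _ _ _ => (1:ℂ)) :=
  fun h => one_ne_zero (h.1 gStar gStar')

/-- **What the guard buys (proved): with guarded `X₁, X₂`, a closing triple whose leg 0 is the zero profile closes through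
the DUAL block alone** — the form is then `Re(|s₁|²𝔅(g₁) + |s₂|²𝔅(g₂) + 2Re(s₁ conj s₂ · conj Y₁))`-type, i.e. the
content is the named dual table `Y₁`, not junk. Stated as: the `f`-row and `f`-column of the main matrix vanish.
[cite: Zhang2022LandauSiegel, §2 (2.16)–(2.17)] -/
theorem gradedMainMatrix_zero_leg {X₁ Y₁ X₂ : PairFunctional} (h₁ : VanishesOnZero X₁) (h₂ : VanishesOnZero X₂)
    (g₁ g₁' g₂ g₂' : ℝ → ℂ) (a : Fin 3) :
    gradedMainMatrix X₁ Y₁ X₂ (fun _ => 0) (fun _ => 0) g₁ g₁' g₂ g₂' 0 a = 0 ∧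
      gradedMainMatrix X₁ Y₁ X₂ (fun _ => 0) (fun _ => 0) g₁ g₁' g₂ g₂' a 0 = 0 := by
  fin_cases a <;>
    simp [gradedMainMatrix, mainTermForm_zero_profile, h₁.1 g₁ g₁', h₂.1 g₂ g₂']

end JunkGuard

end Literature.NumberTheory.LFunctions.Zhang2022.KnifeEdge

end
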